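import Summits.BirchSwinnertonDyer.BirchSwinnertonDyer.Theorems.SchneiderFreeAdditiveX3KYLambdaAlgImprimitiveOfPrintFiveLe
import Summits.BirchSwinnertonDyer.BirchSwinnertonDyer.Theorems.EisensteinPrimesXAcImprimitiveLambdaShift
import HarnessLib

/-!
# Route `SchneiderFreeAdditiveX3` (K1 door): the ALGEBRAIC λ-clause of Keller–Yin 2410.23241 §3.5 at `p ≥ 5`, PART 2 —
# the EQUALITY `λ(𝔛^{Sf}(E_K)) = λ(𝔛^{Sf}_{Gr}(θsub)) + λ(𝔛^{Sf}_{Gr}(θquot))` for the door's curves, IN THE KERNEL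
# modulo PUBLISHED facts (CGLS 2022 §1.2 ×4, Greenberg 2016/2006 ×4)

Cell `bsd-schneider-ideate`, seat `bsd-schneider-door-c5` (prover, generation 24; assembly layer; `--supports` 19177).
PARTITION: board row B6 ∩ X3 ∩ sst-twist, `r = 1` (7 101 pairs; (G-ord, `e = 2`) half 2 560, (M) half 4 541), at
`p ≥ 5`; types-the-object-of nothing new; DERIVES the algebraic half of the `λ`-clause [INV.λ] of crux r3's preprint
input in imprimitive currency; closes none of B6's cells (BSD NOT advanced).  bears_on: K1-door (items 18971/18972 →
19177 r3 `GordTwoBranchIMC`) + K1-wing (20365).  Sequel of `…KYLambdaAlgImprimitiveOfPrintFiveLe` (PART 1: the local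
data of every `Γ_K`-stable line from the non-anomalous clause, and the count / `≤` / conditional `=` of Keller–Yin
2402.12781 Thm. 1.4.1 for every residual pair, modulo CGLS22 Prop. 1.2.5 + Cor. 1.2.6), whose module docstring has the
full story; this part discharges the one E-level input of the equality («`𝔛^{Sf}` has no `p`-torsion») exactly as cell
`bsd-eis`'s `…XAcImprimitiveNoPTorsion` does at a non-split multiplicative prime.

* §3 `xAc_moduleFinite_isTorsion_muInvariant_of_prop14_of_nonAnomalous` — `𝔛^{Sf}` f.g., `Λ`-torsion, `μ = 0` from
  CGLS22 Prop. 14 [PUB] (generation 23's reduction-type-free `residualFinite_of_prop14_of_nonAnomalous` + Greenberg's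
  criterion (A) at `Sf`); `…_of_classX3_of_subSemistableTwist` — the cells at `p ≥ 5`.
* §4 **`lambdaInvariant_xAc_eq_add_of_nonAnomalous_of_facts`** (REDUCTION-TYPE-FREE given the non-anomalous clause) and
  **`lambdaInvariant_xAc_eq_add_of_classX3_of_subSemistableTwist_of_facts`** — the EQUALITY modulo the EIGHT published
  facts of `bsd-eis`'s `lambdaInvariant_xAc_eq_add_of_not_split_of_facts` (CGLS22 Prop. 1.2.5, Prop. 14, Cor. 1.2.6 (i)(ii);
  Greenberg 2016 Prop. 4.1.1, Greenberg 2006 Props. 4.1, 4.2, 3.2), at `p ≥ 5` on BOTH semistable-twist cells of B6 ∩ X3: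
  Keller–Yin 2410.23241 §3.5's "the analysis on the algebraic side is exactly as in [KY24]" AS OUR THEOREM there
  (imprimitive currency `Sf`; the door's `𝔛 = X_ac^∅` differs from `𝔛^{Sf}` by the local λ-shift, not done here);
  `…_of_classX3_of_subGordTwo_of_facts` — the door's (G-ord, `e = 2`) binders.
* §5 **`lambdaInvariant_xAc_empty_add_zpCorank_eq_of_classX3_of_subSemistableTwist_of_facts`** — the door's PRIMITIVE
  dual `𝔛 = X_ac^∅(E_K)` (the module of `thm351_invariants_branch_OPEN`): `X_ac^∅` is f.g. `Λ`-torsion with `μ = 0` and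
  **`λ(X_ac^∅(E_K)) + corank_{ℤ_p}(Sel^{Sf}/Sel^∅) = λ(𝔛^{Sf}_{Gr}(θsub)) + λ(𝔛^{Sf}_{Gr}(θquot))`** modulo the same eight
  published facts — §4 composed with cell `bsd-eis`'s `λ`-shift tool
  (`XAcImprimitiveLambdaShift.lambdaInvariant_eq_add_zpCorank_of_muInvariant_eq_zero`, k5-c2).  What is NOT here: the
  VALUE of the corank (`Σ_{w ∈ Sf} λ(𝒫_w(E))`, Greenberg–Vatsal Prop. 2.4 / Pollack–Weston A.2) and the analytic `λ(𝓛_ε)`.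

HONEST FRAMING: compositions of tree theorems, CONDITIONAL BY NAME on published facts typed as `Prop`s (not proved in
the tree); no definition, no named fact introduced, no `sorry`; the ANALYTIC λ (`λ(𝓛_ε)`) is NOT touched and stays the
preprint's; nothing at `p = 3`; nothing about BSD or a main conjecture is asserted; «closes rung: none».
References: Keller–Yin arXiv:2410.23241 §3.5, Thm. 3.5.1 [KellerYin2024b]; Keller–Yin arXiv:2402.12781 Thm. 1.4.1, §1.4 (e)
[KellerYin2024]; Castella–Grossi–Lee–Skinner, Invent. Math. 227 (2022) §1.2 Prop. 1.2.5, Cor. 1.2.6, Prop. 14, §1.4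
Props. 1.4.1–1.4.2, Cor. 1.4.3 [CastellaGrossiLeeSkinner2022]; Greenberg 2016 Prop. 4.1.1 [Greenberg2016Selmer]; Greenberg
2006 Props. 3.2, 4.1, 4.2 [Greenberg2006]; Greenberg LNM 1716 §1 [GreenbergLNM1716]; Castella 2018 Def. 2.2 [Castella2018];
cell `bsd-eis` p654300 (the non-split twin); this seat p663835 (generation 23).
-/

set_option autoImplicit false
set_option linter.dupNamespace false -- the summit namespace `…BirchSwinnertonDyer.BirchSwinnertonDyer.Theorems` (Sub = Summit, D-0017) trips it

noncomputable section

open scoped Classical Pointwise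

namespace Summit.BirchSwinnertonDyer.BirchSwinnertonDyer.Theorems.SchneiderFreeAdditiveX3.KYLambdaAlg

open WeierstrassCurve NumberField IsDedekindDomain Field
  Literature.NumberTheory.EllipticCurves Literature.NumberTheory.EllipticCurves.IwasawaAlgebra
  Literature.NumberTheory.EllipticCurves.GreenbergSelmer
  Literature.NumberTheory.EllipticCurves.GreenbergVatsal2000
  Literature.NumberTheory.GaloisRepresentations IsDedekindDomain.HeightOneSpectrum
  Literature.NumberTheory.EllipticCurves.Rank1Residual Literature.NumberTheory.EllipticCurves.KellerYin2024
  Literature.NumberTheory.EllipticCurves.IwasawaDual Literature.NumberTheory.EllipticCurves.Castella2018.AcSelmer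
  Literature.NumberTheory.IwasawaTheory Literature.NumberTheory.IwasawaTheory.Greenberg2016
  Literature.NumberTheory.IwasawaTheory.Greenberg2006
  Summit.BirchSwinnertonDyer.Rank1Residual Summit.BirchSwinnertonDyer.Rank1Residual.Additive
  Summit.BirchSwinnertonDyer.Rank1Residual.X2.ResidualDevissageModules
  Summit.BirchSwinnertonDyer.BirchSwinnertonDyer.Theorems
  Summit.BirchSwinnertonDyer.BirchSwinnertonDyer.Theorems.ResidualDevissageNonsplitLocalData
  Summit.BirchSwinnertonDyer.BirchSwinnertonDyer.Theorems.ResidualDevissageNonsplitLambdaIdentityOfFacts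
  Summit.BirchSwinnertonDyer.BirchSwinnertonDyer.Theorems.CumulativeHeegnerInclusionAtThreeResidualDevissage
  Summit.BirchSwinnertonDyer.BirchSwinnertonDyer.Theorems.CumulativeHeegnerInclusionAtThreeLineBaseChange
  Summit.BirchSwinnertonDyer.BirchSwinnertonDyer.Theorems.CumulativeHeegnerInclusionAtThreeTowerFixed
  Summit.BirchSwinnertonDyer.BirchSwinnertonDyer.Theorems.CumulativeHeegnerInclusionAtThreeStubB1LineDeterminant
  Summit.BirchSwinnertonDyer.BirchSwinnertonDyer.Theorems.CumulativeHeegnerInclusionAtThreeBadPlaces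
  Summit.BirchSwinnertonDyer.BirchSwinnertonDyer.Theorems.AdditiveKoly.SplitCompletion
  Summit.BirchSwinnertonDyer.BirchSwinnertonDyer.Theorems.KellerYinLemma511NonsplitOfPrint
  Summit.BirchSwinnertonDyer.BirchSwinnertonDyer.Theorems.SchneiderFreeAdditiveX3
open Literature.NumberTheory.EllipticCurves.CastellaGrossiLeeSkinner2022
  (cor126_residualCharacter_globalLift cor126_residualCharacter_localSurjective
    prop125_characterGrSelmerDual_torsion_muZero_dim prop14_residualCharacterSelmer_finite)

/-! ### §3 `𝔛^{Sf}` is finitely generated `Λ`-torsion with `μ = 0`, from CGLS Prop. 14 and the non-anomalous clause -/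

/-- **`𝔛^{Sf} = X_ac^{Sf}(E_K)` finitely generated, `Λ`-torsion, `μ = 0` at every Eisenstein Heegner datum with the
non-anomalous clause**, from the PUBLISHED CGLS22 Prop. 14 finiteness clause BY NAME: generation 23's reduction-type-free
`KYMuZeroOfPrint.residualFinite_of_prop14_of_nonAnomalous` (`Sel_{v̄}^{Sf}(K_∞, E_K[p^∞])[p]` finite) + Greenberg's
criterion (A) AT `Sf` (`UniversalToricDescentAcDualMuZero.isTorsion_of_finite_pTorsion` / `muInvariant_eq_zero_of_finite_pTorsion`)
+ Castella's unconditional finite generation (`XAc.module_finite`).  (Generation 23 recorded only the `∅` consequence.)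
[cite: CastellaGrossiLeeSkinner2022, §1.2 Prop. 14, §1.4 Props. 17–18 (arXiv:2008.02571; Invent. Math. 227 (2022))]
[cite: GreenbergLNM1716, §1 p. 60] [cite: GreenbergVatsal2000, §2 Prop. (2.8)] [cite: Castella2018, Def. 2.2] -/
theorem xAc_moduleFinite_isTorsion_muInvariant_of_prop14_of_nonAnomalous
    (hfact : prop14_residualCharacterSelmer_finite)
    {p : ℕ} [Fact p.Prime] (W : WeierstrassCurve ℚ) [W.IsElliptic] [W.IsGloballyMinimal]
    (K : Type) [Field K] [NumberField K] (vbar : HeightOneSpectrum (𝓞 K))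
    (κ : ZpExtension K p) (γ : absoluteGaloisGroup K) [Fact (κ.IsTopGenerator γ)]
    (Sf : Finset (HeightOneSpectrum (𝓞 K)))
    (hp2 : 2 < p) (hred : Red W p) (hK : IsImaginaryQuadratic K)
    (hH : SatisfiesHeegnerHypothesis (W.conductorNorm ℤ) K)
    (hsplit : ((Ideal.span {(p : ℤ)}).primesOver (𝓞 K)).ncard = 2)
    (hvbar : ((p : ℕ) : 𝓞 K) ∈ vbar.asIdeal) (hκ : κ.IsAnticyclotomic)
    (hSf : ∀ w : HeightOneSpectrum (𝓞 K), w ∈ Sf ↔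
      (((W.conductorNorm ℤ : ℤ) : 𝓞 K) ∈ w.asIdeal ∧ ((p : ℕ) : 𝓞 K) ∉ w.asIdeal))
    (hna : ∀ (v : HeightOneSpectrum (𝓞 ℚ)), ((p : ℕ) : 𝓞 ℚ) ∈ v.asIdeal →
      ∀ (Φ : AddSubgroup (geomTorsion W (p : ℤ))), Nat.card Φ = p →
      ∀ 𝔓 ∈ v.primesAbove,
        (¬ ∀ g ∈ 𝔓.decompositionSubgroup (absoluteGaloisGroup ℚ), ∀ P ∈ Φ, g • P = P) ∧
          (¬ ∀ g ∈ 𝔓.decompositionSubgroup (absoluteGaloisGroup ℚ),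
            ∀ P : geomTorsion W (p : ℤ), g • P - P ∈ Φ)) :
    Module.Finite (IwasawaAlgebra p) (XAc (W.baseChange K) p κ vbar (↑Sf : Set (HeightOneSpectrum (𝓞 K))) γ) ∧
      Module.IsTorsion (IwasawaAlgebra p) (XAc (W.baseChange K) p κ vbar (↑Sf : Set (HeightOneSpectrum (𝓞 K))) γ) ∧
      muInvariant p (XAc (W.baseChange K) p κ vbar (↑Sf : Set (HeightOneSpectrum (𝓞 K))) γ) = 0 := by
  haveI hEK : (W.baseChange K).IsElliptic := inferInstanceAs (W.map (algebraMap ℚ K)).IsElliptic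
  have hS : (↑Sf : Set (HeightOneSpectrum (𝓞 K))).Finite := Finset.finite_toSet Sf
  have hfin := KYMuZeroOfPrint.residualFinite_of_prop14_of_nonAnomalous hfact W K vbar κ Sf hp2 hred hK hH hsplit hvbar hκ hSf
    (fun v hpv Φ hΦ 𝔓 h𝔓 ↦ hna v hpv Φ hΦ.1 𝔓 h𝔓)
  exact ⟨XAc.module_finite (W.baseChange K) p κ vbar _ γ hS,
    UniversalToricDescentAcDualMuZero.isTorsion_of_finite_pTorsion (W.baseChange K) p κ vbar _ γ hS hfin,
    UniversalToricDescentAcDualMuZero.muInvariant_eq_zero_of_finite_pTorsion (W.baseChange K) p κ vbar _ γ hS hfin⟩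

/-- **On the semistable-twist cells of B6 ∩ X3 at `p ≥ 5`: `𝔛^{Sf}` f.g., `Λ`-torsion, `μ = 0` ⟸ CGLS22 Prop. 14 [PUB]** —
§3 with `hna` from the cells (`ClassX3` supplies `Red`). [cite: CastellaGrossiLeeSkinner2022, §1.2 Prop. 14 (arXiv:2008.02571)]
[cite: Serre1972, §1.11 Prop. 11 and §1.12 Prop. 13] [cite: Castella2018, Def. 2.2] -/
theorem xAc_moduleFinite_isTorsion_muInvariant_of_prop14_of_classX3_of_subSemistableTwist
    (hfact : prop14_residualCharacterSelmer_finite)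
    {p : ℕ} [Fact p.Prime] (W : WeierstrassCurve ℚ) [W.IsElliptic] [W.IsGloballyMinimal]
    (K : Type) [Field K] [NumberField K] (vbar : HeightOneSpectrum (𝓞 K))
    (κ : ZpExtension K p) (γ : absoluteGaloisGroup K) [Fact (κ.IsTopGenerator γ)]
    (Sf : Finset (HeightOneSpectrum (𝓞 K)))
    (hp5 : 5 ≤ p) (hX : ClassX3 W p) (hSST : SubSemistableTwist W p) (hK : IsImaginaryQuadratic K)
    (hH : SatisfiesHeegnerHypothesis (W.conductorNorm ℤ) K)
    (hsplit : ((Ideal.span {(p : ℤ)}).primesOver (𝓞 K)).ncard = 2)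
    (hvbar : ((p : ℕ) : 𝓞 K) ∈ vbar.asIdeal) (hκ : κ.IsAnticyclotomic)
    (hSf : ∀ w : HeightOneSpectrum (𝓞 K), w ∈ Sf ↔
      (((W.conductorNorm ℤ : ℤ) : 𝓞 K) ∈ w.asIdeal ∧ ((p : ℕ) : 𝓞 K) ∉ w.asIdeal)) :
    Module.Finite (IwasawaAlgebra p) (XAc (W.baseChange K) p κ vbar (↑Sf : Set (HeightOneSpectrum (𝓞 K))) γ) ∧
      Module.IsTorsion (IwasawaAlgebra p) (XAc (W.baseChange K) p κ vbar (↑Sf : Set (HeightOneSpectrum (𝓞 K))) γ) ∧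
      muInvariant p (XAc (W.baseChange K) p κ vbar (↑Sf : Set (HeightOneSpectrum (𝓞 K))) γ) = 0 :=
  xAc_moduleFinite_isTorsion_muInvariant_of_prop14_of_nonAnomalous hfact W K vbar κ γ Sf (by omega) hX.1 hK hH hsplit hvbar hκ
    hSf
    (fun _ hpv _ hΦ _ h𝔓 ↦
      SemistableTwistLocalAnyLine.not_fix_and_not_quot_of_classX3_of_subSemistableTwist_of_card_eq W p hp5 hX hSST hpv h𝔓 hΦ)

/-! ### §4 The λ-identity WITH EQUALITY, modulo published facts by name -/

/-- **`λ(𝔛^{Sf}(E_K)) = λ(𝔛^{Sf}_{θsub}) + λ(𝔛^{Sf}_{θquot})` at every Eisenstein Heegner datum with the non-anomalous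
clause and EVERY residual pair, MODULO PUBLISHED FACTS BY NAME** — §2 (`≤`, and `=` granted «`𝔛^{Sf}` has no `p`-torsion»)
with that input DISCHARGED by cell `bsd-eis`'s reduction-type-free `XAcImprimitiveNoPTorsion.xAc_smul_eq_zero_imp_of_facts`
(Greenberg 2016 Prop. 4.1.1 + Greenberg 2006 Props. 4.1/4.2/3.2 by name) and §3 (f.g. / torsion / `μ = 0` from CGLS22
Prop. 14 by name).  Binders: `W/ℚ` globally minimal with `E[p]` reducible (`Red`), `2 < p = v v̄` split (`v̄ ≠ v`), `K`
imaginary quadratic with (Heeg) for `N_W`, `κ` anticyclotomic with generator `γ`, `Sf` = places over `N_W` off `p`, the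
non-anomalous clause `hna` for every order-`p` subgroup of `E[p]` at every `𝔓 ∣ p`, a residual pair `(θsub, θquot)`
(`IsResidualPairOver`), ANY strict dual data `Dsub`, `Dquot`.  REDUCTION-TYPE-FREE twin of `bsd-eis`'s
`lambdaInvariant_xAc_eq_add_of_not_split_of_facts` (p654300).
[cite: KellerYin2024, Thm. 1.4.1, §1.4 (e) (arXiv:2402.12781v2 TeX L1087–1098, L1162–1181)]
[cite: CastellaGrossiLeeSkinner2022, §1.2 Prop. 1.2.5, Prop. 14, Cor. 1.2.6, §1.4 Props. 1.4.1–1.4.2, Cor. 1.4.3 (e-print TeX L681–905)]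
[cite: Greenberg2016Selmer, Prop. 4.1.1 (c)] [cite: Greenberg2006, Props. 3.2, 4.1, 4.2] -/
theorem lambdaInvariant_xAc_eq_add_of_nonAnomalous_of_facts
    (hprop125 : prop125_characterGrSelmerDual_torsion_muZero_dim) (hfact : prop14_residualCharacterSelmer_finite)
    (hlift : cor126_residualCharacter_globalLift) (hlocal : cor126_residualCharacter_localSurjective)
    (h411 : prop411_selmer_isAlmostDivisible) (h41 : prop41_globalEulerPoincareCorank)
    (h42 : prop42_localEulerPoincareCorank) (h32 : prop32_cohomology_isCofinitelyGenerated)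
    {p : ℕ} [Fact p.Prime] (W : WeierstrassCurve ℚ) [W.IsElliptic] [W.IsGloballyMinimal]
    (K : Type) [Field K] [NumberField K] {v : HeightOneSpectrum (𝓞 K)} (vbar : HeightOneSpectrum (𝓞 K))
    (κ : ZpExtension K p) (γ : absoluteGaloisGroup K) [Fact (κ.IsTopGenerator γ)]
    (Sf : Finset (HeightOneSpectrum (𝓞 K)))
    (hp2 : 2 < p) (hred : Red W p)
    (hK : IsImaginaryQuadratic K) (hH : SatisfiesHeegnerHypothesis (W.conductorNorm ℤ) K)
    (hsplit : ((Ideal.span {(p : ℤ)}).primesOver (𝓞 K)).ncard = 2)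
    (hv : ((p : ℕ) : 𝓞 K) ∈ v.asIdeal) (hvbar : ((p : ℕ) : 𝓞 K) ∈ vbar.asIdeal) (hne : vbar ≠ v) (hκ : κ.IsAnticyclotomic)
    (hSf : ∀ w : HeightOneSpectrum (𝓞 K), w ∈ Sf ↔
      (((W.conductorNorm ℤ : ℤ) : 𝓞 K) ∈ w.asIdeal ∧ ((p : ℕ) : 𝓞 K) ∉ w.asIdeal))
    (hna : ∀ (v : HeightOneSpectrum (𝓞 ℚ)), ((p : ℕ) : 𝓞 ℚ) ∈ v.asIdeal →
      ∀ (Φ : AddSubgroup (geomTorsion W (p : ℤ))), Nat.card Φ = p →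
      ∀ 𝔓 ∈ v.primesAbove,
        (¬ ∀ g ∈ 𝔓.decompositionSubgroup (absoluteGaloisGroup ℚ), ∀ P ∈ Φ, g • P = P) ∧
          (¬ ∀ g ∈ 𝔓.decompositionSubgroup (absoluteGaloisGroup ℚ),
            ∀ P : geomTorsion W (p : ℤ), g • P - P ∈ Φ))
    (θsub θquot : FramedGaloisRep K (padicCoeffIntegers (∅ : Set (PadicAlgCl p))) 1)
    (hpair : IsResidualPairOver (W.baseChange K) p θsub θquot)
    (Dsub : GrDualData κ (charModule (∅ : Set (PadicAlgCl p)) θsub) vbar (↑Sf : Set (HeightOneSpectrum (𝓞 K))) γ)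
    (Dquot : GrDualData κ (charModule (∅ : Set (PadicAlgCl p)) θquot) vbar (↑Sf : Set (HeightOneSpectrum (𝓞 K))) γ) :
    lambdaInvariant p (XAc (W.baseChange K) p κ vbar (↑Sf : Set (HeightOneSpectrum (𝓞 K))) γ) =
      lambdaInvariant p Dsub.X + lambdaInvariant p Dquot.X := by
  obtain ⟨hXfin, hXtor, hμ⟩ := xAc_moduleFinite_isTorsion_muInvariant_of_prop14_of_nonAnomalous hfact W K vbar κ γ Sf hp2 hred
    hK hH hsplit hvbar hκ hSf hna
  exact (lambdaInvariant_le_add_of_isResidualPairOver_of_nonAnomalous hprop125 hlift hlocal W K vbar κ γ Sf hp2 hK hH hsplit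
    hvbar hκ hSf hna θsub θquot hpair Dsub Dquot).2.2
    (fun x hx ↦ XAcImprimitiveNoPTorsion.xAc_smul_eq_zero_imp_of_facts h411 h41 h42 h32 W hp2 hK hH hv hvbar hne κ hκ γ Sf hSf
      hXfin hXtor hμ x hx)

/-- **Keller–Yin 2410.23241 §3.5's "the analysis on the algebraic side is exactly as in [KY24]" AS OUR THEOREM at `p ≥ 5` on
BOTH semistable-twist cells of B6 ∩ X3, in imprimitive currency: `λ(X_ac^{Sf}(E_K)) = λ(𝔛^{Sf}_{Gr}(θsub)) + λ(𝔛^{Sf}_{Gr}(θquot))`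
for every globally minimal `W/ℚ` with `ClassX3 W p ∧ SubSemistableTwist W p`, `5 ≤ p = v v̄` split in the Heegner field `K`,
THE anticyclotomic `κ`, EVERY residual pair of `E_K[p]` and all strict dual data — MODULO the eight PUBLISHED facts only**
(CGLS22 Prop. 1.2.5, Prop. 14, Cor. 1.2.6 (i)(ii); Greenberg 2016 Prop. 4.1.1; Greenberg 2006 Props. 4.1, 4.2, 3.2).  §4 with
`hna` from `SemistableTwistLocalAnyLine` (`ClassX3` supplies `Red`).  This is the ALGEBRAIC half of the `λ`-clause of
[INV] `thm351_invariants_branch_OPEN` for the door's curves (the analytic half `λ(𝓛_ε)` and the primitive shift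
`λ(X_ac^∅) = λ(X_ac^{Sf}) − Σ` local terms are not touched here).
[cite: KellerYin2024b, §3.5 first paragraph and Thm. 3.5.1 first sentence (arXiv:2410.23241 p. 20) (preprint; algebraic λ-clause derived at p ≥ 5)]
[cite: KellerYin2024, Thm. 1.4.1 (arXiv:2402.12781v2 TeX L1087–1098)]
[cite: CastellaGrossiLeeSkinner2022, §1.2 Prop. 1.2.5, Prop. 14, Cor. 1.2.6, §1.4 Props. 1.4.1–1.4.2, Cor. 1.4.3]
[cite: Greenberg2016Selmer, Prop. 4.1.1 (c)] [cite: Greenberg2006, Props. 3.2, 4.1, 4.2] [cite: Serre1972, §1.11–1.12] -/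
theorem lambdaInvariant_xAc_eq_add_of_classX3_of_subSemistableTwist_of_facts
    (hprop125 : prop125_characterGrSelmerDual_torsion_muZero_dim) (hfact : prop14_residualCharacterSelmer_finite)
    (hlift : cor126_residualCharacter_globalLift) (hlocal : cor126_residualCharacter_localSurjective)
    (h411 : prop411_selmer_isAlmostDivisible) (h41 : prop41_globalEulerPoincareCorank)
    (h42 : prop42_localEulerPoincareCorank) (h32 : prop32_cohomology_isCofinitelyGenerated)
    {p : ℕ} [Fact p.Prime] (W : WeierstrassCurve ℚ) [W.IsElliptic] [W.IsGloballyMinimal]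
    (K : Type) [Field K] [NumberField K] {v : HeightOneSpectrum (𝓞 K)} (vbar : HeightOneSpectrum (𝓞 K))
    (κ : ZpExtension K p) (γ : absoluteGaloisGroup K) [Fact (κ.IsTopGenerator γ)]
    (Sf : Finset (HeightOneSpectrum (𝓞 K)))
    (hp5 : 5 ≤ p) (hX : ClassX3 W p) (hSST : SubSemistableTwist W p)
    (hK : IsImaginaryQuadratic K) (hH : SatisfiesHeegnerHypothesis (W.conductorNorm ℤ) K)
    (hsplit : ((Ideal.span {(p : ℤ)}).primesOver (𝓞 K)).ncard = 2)
    (hv : ((p : ℕ) : 𝓞 K) ∈ v.asIdeal) (hvbar : ((p : ℕ) : 𝓞 K) ∈ vbar.asIdeal) (hne : vbar ≠ v) (hκ : κ.IsAnticyclotomic)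
    (hSf : ∀ w : HeightOneSpectrum (𝓞 K), w ∈ Sf ↔
      (((W.conductorNorm ℤ : ℤ) : 𝓞 K) ∈ w.asIdeal ∧ ((p : ℕ) : 𝓞 K) ∉ w.asIdeal))
    (θsub θquot : FramedGaloisRep K (padicCoeffIntegers (∅ : Set (PadicAlgCl p))) 1)
    (hpair : IsResidualPairOver (W.baseChange K) p θsub θquot)
    (Dsub : GrDualData κ (charModule (∅ : Set (PadicAlgCl p)) θsub) vbar (↑Sf : Set (HeightOneSpectrum (𝓞 K))) γ)
    (Dquot : GrDualData κ (charModule (∅ : Set (PadicAlgCl p)) θquot) vbar (↑Sf : Set (HeightOneSpectrum (𝓞 K))) γ) :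
    lambdaInvariant p (XAc (W.baseChange K) p κ vbar (↑Sf : Set (HeightOneSpectrum (𝓞 K))) γ) =
      lambdaInvariant p Dsub.X + lambdaInvariant p Dquot.X :=
  lambdaInvariant_xAc_eq_add_of_nonAnomalous_of_facts hprop125 hfact hlift hlocal h411 h41 h42 h32 W K vbar κ γ Sf (by omega) hX.1
    hK hH hsplit hv hvbar hne hκ hSf
    (fun _ hpv _ hΦ _ h𝔓 ↦
      SemistableTwistLocalAnyLine.not_fix_and_not_quot_of_classX3_of_subSemistableTwist_of_card_eq W p hp5 hX hSST hpv h𝔓 hΦ)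
    θsub θquot hpair Dsub Dquot

/-- **The door's cell: (G-ord, `e = 2`) at `p ≥ 5`** (`ClassX3 W p ∧ SubGordTwo W p`, the binders of crux r3
`GordTwoBranchIMC`): `λ(X_ac^{Sf}(E_K)) = λ(𝔛^{Sf}_{Gr}(θsub)) + λ(𝔛^{Sf}_{Gr}(θquot))` modulo the eight published facts.
[cite: KellerYin2024b, §3.5 and Thm. 3.5.1 first sentence (arXiv:2410.23241 p. 20) (preprint; algebraic λ-clause derived at p ≥ 5)]
[cite: CastellaGrossiLeeSkinner2022, §1.2 Prop. 1.2.5, Prop. 14, Cor. 1.2.6, §1.4 Props. 1.4.1–1.4.2]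
[cite: Greenberg2016Selmer, Prop. 4.1.1 (c)] [cite: Greenberg2006, Props. 3.2, 4.1, 4.2] -/
theorem lambdaInvariant_xAc_eq_add_of_classX3_of_subGordTwo_of_facts
    (hprop125 : prop125_characterGrSelmerDual_torsion_muZero_dim) (hfact : prop14_residualCharacterSelmer_finite)
    (hlift : cor126_residualCharacter_globalLift) (hlocal : cor126_residualCharacter_localSurjective)
    (h411 : prop411_selmer_isAlmostDivisible) (h41 : prop41_globalEulerPoincareCorank)
    (h42 : prop42_localEulerPoincareCorank) (h32 : prop32_cohomology_isCofinitelyGenerated)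
    {p : ℕ} [Fact p.Prime] (W : WeierstrassCurve ℚ) [W.IsElliptic] [W.IsGloballyMinimal]
    (K : Type) [Field K] [NumberField K] {v : HeightOneSpectrum (𝓞 K)} (vbar : HeightOneSpectrum (𝓞 K))
    (κ : ZpExtension K p) (γ : absoluteGaloisGroup K) [Fact (κ.IsTopGenerator γ)]
    (Sf : Finset (HeightOneSpectrum (𝓞 K)))
    (hp5 : 5 ≤ p) (hX : ClassX3 W p) (hSG : SubGordTwo W p)
    (hK : IsImaginaryQuadratic K) (hH : SatisfiesHeegnerHypothesis (W.conductorNorm ℤ) K)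
    (hsplit : ((Ideal.span {(p : ℤ)}).primesOver (𝓞 K)).ncard = 2)
    (hv : ((p : ℕ) : 𝓞 K) ∈ v.asIdeal) (hvbar : ((p : ℕ) : 𝓞 K) ∈ vbar.asIdeal) (hne : vbar ≠ v) (hκ : κ.IsAnticyclotomic)
    (hSf : ∀ w : HeightOneSpectrum (𝓞 K), w ∈ Sf ↔
      (((W.conductorNorm ℤ : ℤ) : 𝓞 K) ∈ w.asIdeal ∧ ((p : ℕ) : 𝓞 K) ∉ w.asIdeal))
    (θsub θquot : FramedGaloisRep K (padicCoeffIntegers (∅ : Set (PadicAlgCl p))) 1)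
    (hpair : IsResidualPairOver (W.baseChange K) p θsub θquot)
    (Dsub : GrDualData κ (charModule (∅ : Set (PadicAlgCl p)) θsub) vbar (↑Sf : Set (HeightOneSpectrum (𝓞 K))) γ)
    (Dquot : GrDualData κ (charModule (∅ : Set (PadicAlgCl p)) θquot) vbar (↑Sf : Set (HeightOneSpectrum (𝓞 K))) γ) :
    lambdaInvariant p (XAc (W.baseChange K) p κ vbar (↑Sf : Set (HeightOneSpectrum (𝓞 K))) γ) =
      lambdaInvariant p Dsub.X + lambdaInvariant p Dquot.X :=
  lambdaInvariant_xAc_eq_add_of_classX3_of_subSemistableTwist_of_facts hprop125 hfact hlift hlocal h411 h41 h42 h32 W K vbar κ γ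
    Sf hp5 hX (Or.inr hSG) hK hH hsplit hv hvbar hne hκ hSf θsub θquot hpair Dsub Dquot


/-! ### §5 The door's PRIMITIVE dual: `λ(X_ac^∅) + corank_{ℤ_p}(Sel^{Sf}/Sel^∅) = λ(𝔛^{Sf}_{θsub}) + λ(𝔛^{Sf}_{θquot})` -/

/-- **The algebraic `λ`-clause of Keller–Yin 2410.23241 Thm. 3.5.1 for the door's own module `𝔛 = X_ac^∅(E_K)`, at `p ≥ 5`
on BOTH semistable-twist cells, modulo the eight published facts:** `X_ac^∅(E_K)` is finitely generated, `Λ`-torsion with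
`μ = 0`, and `λ(X_ac^∅(E_K)) + corank_{ℤ_p}(Sel_{v̄}^{Sf}/Sel_{v̄}^∅) = λ(Dsub.X) + λ(Dquot.X)` for every residual pair of
`E_K[p]` and all strict dual data at `Sf` — §4 composed with the `λ`-shift
`XAcImprimitiveLambdaShift.lambdaInvariant_eq_add_zpCorank_of_muInvariant_eq_zero` (`∅ ⊆ Sf`, fed §3's f.g./torsion/`μ = 0`
at `Sf`).  The corank is the algebraic local term `Σ_{w ∈ Sf} λ(𝒫_w(E))` of Greenberg–Vatsal / CGLS Thm. 1.5.1's proof (its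
evaluation is NOT done here).  With this, the `λ`-clause of [INV] `thm351_invariants_branch_OPEN` at `p ≥ 5` reads: the branch
frame's first unit coefficient sits at `λ(Dsub.X) + λ(Dquot.X) − corank` — an identity whose remaining content is ANALYTIC
(`λ(𝓛_ε)` via the Eisenstein congruence, Katz, Hida, Rubin).
[cite: KellerYin2024b, Thm. 3.5.1 first sentence "λ(𝔛) = λ(𝓛_ε)" (arXiv:2410.23241 p. 20) (preprint; algebraic side derived at p ≥ 5)]
[cite: KellerYin2024, Thm. 1.4.1 and proof of Thm. 1.5.1 (arXiv:2402.12781v2 TeX L1087–1098, L1358–1360)]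
[cite: CastellaGrossiLeeSkinner2022, §1.2 Prop. 1.2.5, Prop. 14, Cor. 1.2.6, §1.4, proof of Thm. 1.5.1]
[cite: GreenbergVatsal2000, §2 Cor. (2.3) and p. 21] [cite: Greenberg2016Selmer, Prop. 4.1.1 (c)] [cite: Greenberg2006, Props. 3.2, 4.1, 4.2] -/
theorem lambdaInvariant_xAc_empty_add_zpCorank_eq_of_classX3_of_subSemistableTwist_of_facts
    (hprop125 : prop125_characterGrSelmerDual_torsion_muZero_dim) (hfact : prop14_residualCharacterSelmer_finite)
    (hlift : cor126_residualCharacter_globalLift) (hlocal : cor126_residualCharacter_localSurjective)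
    (h411 : prop411_selmer_isAlmostDivisible) (h41 : prop41_globalEulerPoincareCorank)
    (h42 : prop42_localEulerPoincareCorank) (h32 : prop32_cohomology_isCofinitelyGenerated)
    {p : ℕ} [Fact p.Prime] (W : WeierstrassCurve ℚ) [W.IsElliptic] [W.IsGloballyMinimal]
    (K : Type) [Field K] [NumberField K] {v : HeightOneSpectrum (𝓞 K)} (vbar : HeightOneSpectrum (𝓞 K))
    (κ : ZpExtension K p) (γ : absoluteGaloisGroup K) [Fact (κ.IsTopGenerator γ)]
    (Sf : Finset (HeightOneSpectrum (𝓞 K)))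
    (hp5 : 5 ≤ p) (hX : ClassX3 W p) (hSST : SubSemistableTwist W p)
    (hK : IsImaginaryQuadratic K) (hH : SatisfiesHeegnerHypothesis (W.conductorNorm ℤ) K)
    (hsplit : ((Ideal.span {(p : ℤ)}).primesOver (𝓞 K)).ncard = 2)
    (hv : ((p : ℕ) : 𝓞 K) ∈ v.asIdeal) (hvbar : ((p : ℕ) : 𝓞 K) ∈ vbar.asIdeal) (hne : vbar ≠ v) (hκ : κ.IsAnticyclotomic)
    (hSf : ∀ w : HeightOneSpectrum (𝓞 K), w ∈ Sf ↔
      (((W.conductorNorm ℤ : ℤ) : 𝓞 K) ∈ w.asIdeal ∧ ((p : ℕ) : 𝓞 K) ∉ w.asIdeal))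
    (θsub θquot : FramedGaloisRep K (padicCoeffIntegers (∅ : Set (PadicAlgCl p))) 1)
    (hpair : IsResidualPairOver (W.baseChange K) p θsub θquot)
    (Dsub : GrDualData κ (charModule (∅ : Set (PadicAlgCl p)) θsub) vbar (↑Sf : Set (HeightOneSpectrum (𝓞 K))) γ)
    (Dquot : GrDualData κ (charModule (∅ : Set (PadicAlgCl p)) θquot) vbar (↑Sf : Set (HeightOneSpectrum (𝓞 K))) γ) :
    Module.Finite (IwasawaAlgebra p) (XAc (W.baseChange K) p κ vbar (∅ : Set (HeightOneSpectrum (𝓞 K))) γ) ∧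
      Module.IsTorsion (IwasawaAlgebra p) (XAc (W.baseChange K) p κ vbar (∅ : Set (HeightOneSpectrum (𝓞 K))) γ) ∧
      muInvariant p (XAc (W.baseChange K) p κ vbar (∅ : Set (HeightOneSpectrum (𝓞 K))) γ) = 0 ∧
      lambdaInvariant p (XAc (W.baseChange K) p κ vbar (∅ : Set (HeightOneSpectrum (𝓞 K))) γ) +
          zpCorank (↥(selmerAc (W.baseChange K) p κ vbar (↑Sf : Set (HeightOneSpectrum (𝓞 K)))) ⧸
            (selmerAc (W.baseChange K) p κ vbar (∅ : Set (HeightOneSpectrum (𝓞 K)))).addSubgroupOf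
              (selmerAc (W.baseChange K) p κ vbar (↑Sf : Set (HeightOneSpectrum (𝓞 K))))) p =
        lambdaInvariant p Dsub.X + lambdaInvariant p Dquot.X := by
  haveI hEK : (W.baseChange K).IsElliptic := inferInstanceAs (W.map (algebraMap ℚ K)).IsElliptic
  obtain ⟨hXfin, hXtor, hμ⟩ := xAc_moduleFinite_isTorsion_muInvariant_of_prop14_of_classX3_of_subSemistableTwist hfact W K vbar
    κ γ Sf hp5 hX hSST hK hH hsplit hvbar hκ hSf
  haveI := hXfin
  obtain ⟨hfin₀, htor₀, hμ₀, -, hshift⟩ :=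
    XAcImprimitiveLambdaShift.lambdaInvariant_eq_add_zpCorank_of_muInvariant_eq_zero (W.baseChange K) p κ vbar γ
      (Set.empty_subset (↑Sf : Set (HeightOneSpectrum (𝓞 K)))) hXtor hμ
  have heq := lambdaInvariant_xAc_eq_add_of_classX3_of_subSemistableTwist_of_facts hprop125 hfact hlift hlocal h411 h41 h42 h32
    W K vbar κ γ Sf hp5 hX hSST hK hH hsplit hv hvbar hne hκ hSf θsub θquot hpair Dsub Dquot
  exact ⟨hfin₀, htor₀, hμ₀, by rw [← heq, hshift]⟩

end Summit.BirchSwinnertonDyer.BirchSwinnertonDyer.Theorems.SchneiderFreeAdditiveX3.KYLambdaAlg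

end
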